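import Mathlib
import HarnessLib
import Literature.Geometry.DiscreteGeometry.LayerStackings
import Literature.Geometry.DiscreteGeometry.LayerShellPatterns
import Literature.MathematicalPhysics.StatisticalMechanics.BarlowStacking

/-!
# Local layer-propagation lemmas for the finite-ball form of Hales, *Dense Sphere Packings* §1.3 (X):
# the sharp "no room" bound and the finite-ball statement from a frame

Route `PricedLinkCensus`, crux `SoftLayerPropagation` (stmt-AtomisticToContinuum-14233), line
`Sketch`, tenth helper file for the stub `stub_ballPropagation`.

* `exists_dist_sq_barlowPos_le` — every point of `ℝ³` is at squared distance `≤ 22/9` from the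
  close-packed stacking `barlowStacking 2 𝗁 s` (the bound inside the tree's
  `exists_dist_barlowPos_lt_two`, recorded sharply: `√22/3 ≈ 1.5635` instead of `2`);
* `inter_closedBall_eq_image_barlowStacking_inter_sharp`,
  `exists_isometry_inter_closedBall_eq_of_frame_sharp` — NO ROOM on a ball with the sharp radius:
  if every point of the moved stacking within distance `≤ R + √22/3` of `u` is a centre of the
  packing, then the packing and the moved stacking agree on `closedBall u R`; hence the conclusion
  of the stub (`R = 7`) from "the stacking points within `8.5635` of the centre are centres".

All statements are elementary ([folklore]).
-/

noncomputable section

namespace Summit.AtomisticToContinuum.Crystallization.Theorems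

open Literature.Geometry.DiscreteGeometry Literature.MathematicalPhysics.StatisticalMechanics
open RealInnerProductSpace

/-- **No room, sharply**: every point of `ℝ³` is at squared distance `≤ 16/9 + 𝗁²/4 = 22/9` from
`barlowStacking 2 𝗁 s`. [folklore] -/
theorem exists_dist_sq_barlowPos_le (s : ℤ → ℤ) (x : EuclideanSpace ℝ (Fin 3)) :
    ∃ k i j : ℤ, dist x (barlowPos 2 layerSpacing s k i j) ^ 2 ≤ 22 / 9 := by
  -- adapted from `exists_dist_barlowPos_lt_two` (LayerStackings.lean)
  have hh := layerSpacing_pos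
  have hs3 : Real.sqrt 3 ^ 2 = 3 := sqrt_three_sq
  have hs3pos : 0 < Real.sqrt 3 := by positivity
  set k : ℤ := round (x 2 / layerSpacing) with hk
  set L : ℝ := (haggLabel s k : ℝ) with hL
  set jr : ℝ := x 1 / Real.sqrt 3 - L / 3 with hjr
  set ir : ℝ := (x 0 - jr - L) / 2 with hir
  obtain ⟨a, b, hab⟩ := exists_corner_form_le (Int.fract_nonneg ir) (Int.fract_lt_one ir).le
    (Int.fract_nonneg jr) (Int.fract_lt_one jr).le
  refine ⟨k, ⌊ir⌋ + a, ⌊jr⌋ + b, ?_⟩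
  have hvert : (x 2 - k * layerSpacing) ^ 2 ≤ 2 / 3 := by
    have h1 : |x 2 / layerSpacing - k| ≤ 1 / 2 := by rw [hk]; exact abs_sub_round _
    have h2 : x 2 - k * layerSpacing = layerSpacing * (x 2 / layerSpacing - k) := by field_simp
    rw [h2, mul_pow, layerSpacing_sq]
    have h3 : (x 2 / layerSpacing - k) ^ 2 ≤ 1 / 4 := by
      rw [← sq_abs]; nlinarith [abs_nonneg (x 2 / layerSpacing - k)]
    nlinarith
  have hx1 : x 1 = Real.sqrt 3 * (jr + L / 3) := by
    rw [hjr]; field_simp; ring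
  have hx0 : x 0 = 2 * ir + jr + L := by rw [hir]; ring
  have hfi : ir - ⌊ir⌋ = Int.fract ir := rfl
  have hfj : jr - ⌊jr⌋ = Int.fract jr := rfl
  rw [dist_sq_fin3, barlowPos_apply_zero, barlowPos_apply_one, barlowPos_apply_two, ← hL, hx0, hx1]
  have e0 : 2 * ir + jr + L - 2 * ((((⌊ir⌋ + a : ℤ) : ℝ)) + (((⌊jr⌋ + b : ℤ) : ℝ)) / 2 + L / 2) =
      2 * (Int.fract ir - a) + (Int.fract jr - b) := by rw [← hfi, ← hfj]; push_cast; ring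
  have e1 : Real.sqrt 3 * (jr + L / 3) - 2 * Real.sqrt 3 / 2 * ((((⌊jr⌋ + b : ℤ) : ℝ)) + L / 3) =
      Real.sqrt 3 * (Int.fract jr - b) := by rw [← hfj]; push_cast; ring
  rw [e0, e1, mul_pow, hs3]
  nlinarith [hab, hvert]

/-- Hence every point is within `√22/3` of the stacking. [folklore] -/
theorem exists_dist_barlowPos_le (s : ℤ → ℤ) (x : EuclideanSpace ℝ (Fin 3)) :
    ∃ k i j : ℤ, dist x (barlowPos 2 layerSpacing s k i j) ≤ Real.sqrt 22 / 3 := by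
  obtain ⟨k, i, j, h⟩ := exists_dist_sq_barlowPos_le s x
  refine ⟨k, i, j, ?_⟩
  have h1 : (Real.sqrt 22 / 3) ^ 2 = 22 / 9 := by
    rw [div_pow, Real.sq_sqrt (by norm_num)]; norm_num
  exact (pow_le_pow_iff_left₀ dist_nonneg (by positivity) two_ne_zero).1 (h1 ▸ h)

/-- **No room on a ball, sharp radius.**  If every point of the moved close-packed stacking
`g '' barlowStacking 2 𝗁 s` at distance `≤ R + √22/3` from `u` belongs to the packing `V`, then
`V ∩ closedBall u R = g '' barlowStacking 2 𝗁 s ∩ closedBall u R`. [folklore] -/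
theorem inter_closedBall_eq_image_barlowStacking_inter_sharp {V : Set (EuclideanSpace ℝ (Fin 3))}
    (hV : IsUnitBallPacking V) (g : EuclideanSpace ℝ (Fin 3) ≃ᵢ EuclideanSpace ℝ (Fin 3))
    (s : ℤ → ℤ) {u : EuclideanSpace ℝ (Fin 3)} {R : ℝ}
    (hsub : ∀ y ∈ g '' barlowStacking 2 layerSpacing s, dist y u ≤ R + Real.sqrt 22 / 3 → y ∈ V) :
    V ∩ Metric.closedBall u R = g '' barlowStacking 2 layerSpacing s ∩ Metric.closedBall u R := by
  have h22 : Real.sqrt 22 / 3 < 2 := by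
    rw [div_lt_iff₀ (by norm_num : (0 : ℝ) < 3)]
    rw [show (2 : ℝ) * 3 = Real.sqrt 36 by
      rw [show (36 : ℝ) = 6 ^ 2 by norm_num, Real.sqrt_sq (by norm_num)]; norm_num]
    exact Real.sqrt_lt_sqrt (by norm_num) (by norm_num)
  ext x
  simp only [Set.mem_inter_iff, Metric.mem_closedBall]
  constructor
  · rintro ⟨hx, hxu⟩
    obtain ⟨k, i, j, hd⟩ := exists_dist_barlowPos_le s (g.symm x)
    set y : EuclideanSpace ℝ (Fin 3) := g (barlowPos 2 layerSpacing s k i j) with hy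
    have hyS : y ∈ g '' barlowStacking 2 layerSpacing s := ⟨_, barlowPos_mem k i j, rfl⟩
    have hxy : dist x y ≤ Real.sqrt 22 / 3 := by
      have : dist (g (g.symm x)) (g (barlowPos 2 layerSpacing s k i j)) ≤ Real.sqrt 22 / 3 := by
        rwa [g.dist_eq]
      simpa [hy] using this
    have hyu : dist y u ≤ R + Real.sqrt 22 / 3 := by
      have h1 : dist y u ≤ dist y x + dist x u := dist_triangle _ _ _
      rw [dist_comm y x] at h1
      linarith
    have hyV : y ∈ V := hsub y hyS hyu
    have hxy' : x = y := hV hx hyV (by linarith)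
    exact ⟨hxy' ▸ hyS, hxu⟩
  · rintro ⟨hy, hyu⟩
    exact ⟨hsub x hy (by linarith [Real.sqrt_nonneg 22]), hyu⟩

/-- **The finite-ball statement from a frame, sharp radius.**  If, after moving the packing by
`x ↦ p₀ + L x`, every point of `barlowStacking 2 𝗁 s` within distance `≤ R + √22/3` of the moved
centre `L⁻¹ (u − p₀)` is a centre, then `V ∩ closedBall u R` is the image of the stacking under
`g = (p₀ + ·) ∘ L`, cut to the ball. [folklore] -/
theorem exists_isometry_inter_closedBall_eq_of_frame_sharp {V : Set (EuclideanSpace ℝ (Fin 3))}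
    (hV : IsUnitBallPacking V) (p₀ : EuclideanSpace ℝ (Fin 3))
    (L : EuclideanSpace ℝ (Fin 3) ≃ₗᵢ[ℝ] EuclideanSpace ℝ (Fin 3)) (u : EuclideanSpace ℝ (Fin 3))
    (R : ℝ) {s : ℤ → ℤ} (hs : IsHaggSeq s)
    (hsub : ∀ k i j : ℤ, dist (barlowPos 2 layerSpacing s k i j) (L.symm (u - p₀)) ≤ R + Real.sqrt 22 / 3 →
      p₀ + L (barlowPos 2 layerSpacing s k i j) ∈ V) :
    ∃ s : ℤ → ℤ, IsHaggSeq s ∧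
      ∃ g : EuclideanSpace ℝ (Fin 3) ≃ᵢ EuclideanSpace ℝ (Fin 3),
        V ∩ Metric.closedBall u R =
          g '' barlowStacking 2 (2 * Real.sqrt (2 / 3)) s ∩ Metric.closedBall u R := by
  refine ⟨s, hs, L.toIsometryEquiv.trans (IsometryEquiv.addLeft p₀), ?_⟩
  apply inter_closedBall_eq_image_barlowStacking_inter_sharp hV
  rintro _ ⟨x, ⟨k, i, j, rfl⟩, rfl⟩ hd
  simp only [IsometryEquiv.trans_apply, IsometryEquiv.addLeft_apply,
    LinearIsometryEquiv.coe_toIsometryEquiv] at hd ⊢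
  apply hsub
  have e : dist (barlowPos 2 layerSpacing s k i j) (L.symm (u - p₀)) =
      dist (p₀ + L (barlowPos 2 layerSpacing s k i j)) u := by
    rw [← L.dist_map, LinearIsometryEquiv.apply_symm_apply, ← dist_add_left p₀, add_sub_cancel]
  rw [e]; exact hd

/-- **Registered sub-goal `ballPropagation_noRoomSharp`** of the crux item (the stub from a frame,
sharp radius, in closed form): `exists_isometry_inter_closedBall_eq_of_frame_sharp`. [folklore] -/
theorem ballPropagation_noRoomSharp :
    ∀ (V : Set (EuclideanSpace ℝ (Fin 3))), Literature.Geometry.DiscreteGeometry.IsUnitBallPacking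
    V → ∀ (p₀ : EuclideanSpace ℝ (Fin 3)) (L : EuclideanSpace ℝ (Fin 3) ≃ₗᵢ[ℝ] EuclideanSpace ℝ
    (Fin 3)) (u : EuclideanSpace ℝ (Fin 3)) (R : ℝ) (s : ℤ → ℤ),
    Literature.MathematicalPhysics.StatisticalMechanics.IsHaggSeq s → (∀ k i j : ℤ, dist
    (Literature.MathematicalPhysics.StatisticalMechanics.barlowPos 2
    Literature.Geometry.DiscreteGeometry.layerSpacing s k i j) (L.symm (u - p₀)) ≤ R + Real.sqrt 22
    / 3 → p₀ + L (Literature.MathematicalPhysics.StatisticalMechanics.barlowPos 2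
    Literature.Geometry.DiscreteGeometry.layerSpacing s k i j) ∈ V) → ∃ s : ℤ → ℤ,
    Literature.MathematicalPhysics.StatisticalMechanics.IsHaggSeq s ∧ ∃ g : EuclideanSpace ℝ (Fin
    3) ≃ᵢ EuclideanSpace ℝ (Fin 3), V ∩ Metric.closedBall u R = g ''
    Literature.MathematicalPhysics.StatisticalMechanics.barlowStacking 2 (2 * Real.sqrt (2 / 3)) s
    ∩ Metric.closedBall u R :=
  fun _ hV p₀ L u R _ hs hsub => exists_isometry_inter_closedBall_eq_of_frame_sharp hV p₀ L u R hs hsub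

end Summit.AtomisticToContinuum.Crystallization.Theorems

end
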